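import Summits.QuantumFields.YangMills.Theorems.LuscherReductionDressedRitzPolyakovLiftEuclideanCurrency
import HarnessLib

/-!
# Route `LuscherReduction`, item `DressedRitz` (stmt-QuantumFields-20205), line «polyakovlift» r5 — LOG-CONVEXITY of the connected correlator in the
# separation: `corr_{t+1}² ≤ corr_t · corr_{t+2}` (monotone effective mass), nonnegativity of `corr_{t,ii}` and of the leakage defect of (o4)

Support module (LEAD prover ym-lead-20205-polyakovlift g0; `--supports stmt-QuantumFields-20205`, helper).  Standard transfer-matrix lore, kernel-checked
over the tree's objects: for a physical vector `v` and the symmetric, form-positive transfer operator `K_β` (`β ≥ 0`),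

* `l2_iterate_diag_nonneg`   — `0 ≤ ⟨v, K^[t] v⟩` (even `t`: a Gram number; odd `t`: a `qform` of `K^[s]v`);
* `l2_iterate_logConvex`     — `⟨v,K^[t+1]v⟩² ≤ ⟨v,K^[t]v⟩·⟨v,K^[t+2]v⟩` (Cauchy–Schwarz for `l2`, resp. for the positive form `qform`, after moving powers
                               across with `l2_iterate_polar`);
* `corr_diag_nonneg`, ★ `corr_logConvex` — the same for `corr β φ G t i i` (`λ₀^t`-normalised): the per-step ratio `corr_{t+1,ii}/corr_{t,ii}` is
                               NON-DECREASING in `t`, i.e. the effective mass `−log(corr_{t+1}/corr_t)` is non-increasing (approach to the plateau from above);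
* ★ `leakage_defect_nonneg`  — `0 ≤ corr_{2m+2,ii}·corr_{2m,ii} − corr_{2m+1,ii}²`: the quantity that S-LEAK's (o4) (`leakageClause_iff_corr`) requires to be
                               `≤ C(λ³/L²)corr_{2m,ii}²` is nonnegative — (o4) is a genuine smallness statement, never vacuous by sign.

HONEST FRAMING: fixed-lattice functional analysis on the conditional femto rung R2b1; no estimate toward any stub; nothing here bears on infinite volume, the
continuum limit or the Clay gap.  References: M. Lüscher, U. Wolff, NPB 339 (1990) 222 [cite: LuscherWolff1990]; E. Seiler, LNP 159 [cite: SeilerLNP1982, §3].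
-/

set_option autoImplicit false

noncomputable section

open MeasureTheory Filter Topology Real
open Literature.MathematicalPhysics.QuantumFieldTheory (GaugeConfig Site gaugeTransform)
open scoped BigOperators

namespace Summit.QuantumFields.YangMills.Theorems.FemtoTransferGap.PolyakovLift

open Summit.QuantumFields.YangMills.Theorems.FemtoTransferGap

/-! ## §1 Raw moments `⟨v, K^[t] v⟩` -/

/-- `0 ≤ ⟨v, K_β^[t] v⟩` for physical `v`, `β ≥ 0`. [folklore] -/
theorem l2_iterate_diag_nonneg {M : ℕ} [NeZero M] {β : ℝ} (hβ : 0 ≤ β) {v : GaugeConfig 3 M SU2 → ℝ} (hv : IsPhys v) (t : ℕ) :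
    0 ≤ l2 v ((transferApply (L := M) β)^[t] v) := by
  obtain ⟨s, rfl | rfl⟩ := Nat.even_or_odd' t
  · -- even: a Gram number
    rw [show 2 * s = s + s by ring, ← l2_iterate_polar β hv hv s s]
    exact l2_self_nonneg _
  · -- odd: a positive form
    rw [show 2 * s + 1 = s + (s + 1) by ring, ← l2_iterate_polar β hv hv s (s + 1), Function.iterate_succ_apply',
      ← qform_eq_l2_transferApply]
    exact qform_su2Rep_self_nonneg hβ (isPhys_iterate_transferApply β hv s)

/-- **Log-convexity of the moments**: `⟨v,K^[t+1]v⟩² ≤ ⟨v,K^[t]v⟩·⟨v,K^[t+2]v⟩` (physical `v`, `β ≥ 0`). [folklore] -/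
theorem l2_iterate_logConvex {M : ℕ} [NeZero M] {β : ℝ} (hβ : 0 ≤ β) {v : GaugeConfig 3 M SU2 → ℝ} (hv : IsPhys v) (t : ℕ) :
    l2 v ((transferApply (L := M) β)^[t + 1] v) ^ 2 ≤ l2 v ((transferApply β)^[t] v) * l2 v ((transferApply β)^[t + 2] v) := by
  have hs := fun n => isPhys_iterate_transferApply β hv n
  obtain ⟨s, rfl | rfl⟩ := Nat.even_or_odd' t
  · -- t = 2s: Cauchy–Schwarz for `l2` with `a = K^s v`, `b = K^{s+1} v`
    have h1 : l2 v ((transferApply β)^[2 * s + 1] v) = l2 ((transferApply β)^[s] v) ((transferApply β)^[s + 1] v) := by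
      rw [l2_iterate_polar β hv hv]; congr 2; omega
    have h0 : l2 v ((transferApply β)^[2 * s] v) = l2 ((transferApply β)^[s] v) ((transferApply β)^[s] v) := by
      rw [l2_iterate_polar β hv hv]; congr 2; omega
    have h2 : l2 v ((transferApply β)^[2 * s + 2] v) = l2 ((transferApply β)^[s + 1] v) ((transferApply β)^[s + 1] v) := by
      rw [l2_iterate_polar β hv hv]; congr 2; omega
    rw [h1, h0, h2]
    exact sq_l2_le (hs s) (hs (s + 1))
  · -- t = 2s+1: Cauchy–Schwarz for `qform` with `a = K^s v`, `b = K^{s+1} v`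
    have h1 : l2 v ((transferApply β)^[2 * s + 1 + 1] v) =
        qform su2Rep β ((transferApply β)^[s] v) ((transferApply β)^[s + 1] v) := by
      rw [qform_eq_l2_transferApply, ← Function.iterate_succ_apply' (transferApply β) (s + 1), l2_iterate_polar β hv hv]
      congr 2; omega
    have h0 : l2 v ((transferApply β)^[2 * s + 1] v) = qform su2Rep β ((transferApply β)^[s] v) ((transferApply β)^[s] v) := by
      rw [qform_eq_l2_transferApply, ← Function.iterate_succ_apply' (transferApply β) s, l2_iterate_polar β hv hv]
      congr 2; omega
    have h2 : l2 v ((transferApply β)^[2 * s + 1 + 2] v) =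
        qform su2Rep β ((transferApply β)^[s + 1] v) ((transferApply β)^[s + 1] v) := by
      rw [qform_eq_l2_transferApply, ← Function.iterate_succ_apply' (transferApply β) (s + 1), l2_iterate_polar β hv hv]
      congr 2; omega
    rw [h1, h0, h2]
    exact sq_qform_le hβ (hs s) (hs (s + 1))

/-! ## §2 The normalised connected correlator -/

/-- `0 ≤ corr β φ G t i i` (`β > 0`). [folklore] -/
theorem corr_diag_nonneg {M : ℕ} [NeZero M] {k : ℕ} {β : ℝ} (hβ : 0 < β) {φ : GaugeConfig 3 M SU2 → ℝ} (hφ : IsPhys φ)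
    {G : Fin k → (GaugeConfig 3 M SU2 → ℝ)} (hG : ∀ i, IsPhys (G i)) (t : ℕ) (i : Fin k) : 0 ≤ corr β φ G t i i :=
  div_nonneg (l2_iterate_diag_nonneg hβ.le (OpPlat.isPhys_ins hφ (hG i)) t) (pow_nonneg (levelValue_su2Rep_pos hβ 0).le _)

/-- ★ **Log-convexity of `corr` in the separation**: `corr_{t+1,ii}² ≤ corr_{t,ii}·corr_{t+2,ii}` — the effective mass is non-increasing in `t`.
[cite: LuscherWolff1990] -/
theorem corr_logConvex {M : ℕ} [NeZero M] {k : ℕ} {β : ℝ} (hβ : 0 < β) {φ : GaugeConfig 3 M SU2 → ℝ} (hφ : IsPhys φ)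
    {G : Fin k → (GaugeConfig 3 M SU2 → ℝ)} (hG : ∀ i, IsPhys (G i)) (t : ℕ) (i : Fin k) :
    corr β φ G (t + 1) i i ^ 2 ≤ corr β φ G t i i * corr β φ G (t + 2) i i := by
  have hl0 : 0 < levelValue su2Rep M β 0 := levelValue_su2Rep_pos hβ 0
  have h := l2_iterate_logConvex hβ.le (OpPlat.isPhys_ins hφ (hG i)) t
  unfold corr
  rw [div_pow, div_mul_div_comm, ← pow_mul, ← pow_add, show (t + 1) * 2 = t + (t + 2) by ring]
  exact div_le_div_of_nonneg_right h (pow_nonneg hl0.le _)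

/-- ★ **The leakage defect of (o4) is nonnegative**: `0 ≤ corr_{2m+2,ii}·corr_{2m,ii} − corr_{2m+1,ii}²`. [cite: LuscherWolff1990] -/
theorem leakage_defect_nonneg {M : ℕ} [NeZero M] {k : ℕ} {β : ℝ} (hβ : 0 < β) {φ : GaugeConfig 3 M SU2 → ℝ} (hφ : IsPhys φ)
    {G : Fin k → (GaugeConfig 3 M SU2 → ℝ)} (hG : ∀ i, IsPhys (G i)) (m : ℕ) (i : Fin k) :
    0 ≤ corr β φ G (2 * m + 2) i i * corr β φ G (2 * m) i i - corr β φ G (2 * m + 1) i i ^ 2 := by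
  have h := corr_logConvex hβ hφ hG (2 * m) i
  linarith [h, mul_comm (corr β φ G (2 * m + 2) i i) (corr β φ G (2 * m) i i)]

/-- The per-step ratio is non-decreasing: `corr_{t+1}/corr_t ≤ corr_{t+2}/corr_{t+1}` whenever `corr_t, corr_{t+1} > 0`. [cite: LuscherWolff1990] -/
theorem corr_ratio_mono {M : ℕ} [NeZero M] {k : ℕ} {β : ℝ} (hβ : 0 < β) {φ : GaugeConfig 3 M SU2 → ℝ} (hφ : IsPhys φ)
    {G : Fin k → (GaugeConfig 3 M SU2 → ℝ)} (hG : ∀ i, IsPhys (G i)) (t : ℕ) (i : Fin k)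
    (h0 : 0 < corr β φ G t i i) (h1 : 0 < corr β φ G (t + 1) i i) :
    corr β φ G (t + 1) i i / corr β φ G t i i ≤ corr β φ G (t + 2) i i / corr β φ G (t + 1) i i := by
  rw [div_le_div_iff₀ h0 h1, ← sq, mul_comm]
  exact corr_logConvex hβ hφ hG t i

end Summit.QuantumFields.YangMills.Theorems.FemtoTransferGap.PolyakovLift

end
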